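import Summits.HubbardSuperconductivity.HubbardSuperconductivity.Theorems.FunctionFieldCertificateWindowInfraredBoundReductions
import Summits.HubbardSuperconductivity.HubbardSuperconductivity.Theorems.FunctionFieldCertificateMesoscopicPairOrderBloch
import Literature.MathematicalPhysics.QuantumLattice.FockRelabel
import Literature.MathematicalPhysics.QuantumLattice.PairFieldMomentum
import HarnessLib

/-!
# Crux `WindowInfraredBound` (stmt-HubbardSuperconductivity-1089):
# Bloch reduction — only translation-covariant ground states need to be checked

Support file for the crux (routes `FunctionFieldCertificate` / `KacWindowPenalty` /
`GibbsMajorant`; line lead c10). The crux bounds the window pair weight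
`T_ε(ψ) = Σ_{m ≠ 0, |q_m| ≤ ε} ‖Δ_d(m) ψ‖² / L²` from ABOVE in EVERY normalised
`(N_L, S^z = 0)`-sector ground state `ψ` of `H_L = hubbardTorus 2 L 1 U` — including every
superposition inside a degenerate ground eigenspace (STRATEGY-CENSUS v2, S-s1.3 / N-s1.1:
"degenerate-multiplet amplification"). This file discharges the translation part of that
bookkeeping once and for all:

* §1 `relabel_translate_pairFieldAt`: the momentum-resolved pair field is translation COVARIANT,
  `T_v Δ_g(m) T_v⁻¹ = χ_m(v) Δ_g(m)`, hence `Δ_g(m)ᴴ Δ_g(m)` and every real-weighted mode sum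
  `A_w = Σ_m w_m • Δ_g(m)ᴴ Δ_g(m)` (the window operator for `w = 1_{window}/L²`) are translation
  INVARIANT and Hermitian.
* §2 `forall_ground_modeSum_le_of_bloch`: for any real weights `w`, any form factor `g`, any
  `(t, U, N, M)` and any bound `b`, if `Σ_m w_m ‖Δ_g(m) ψ‖² ≤ b` holds for every normalised sector
  ground state that is an eigenvector of EVERY lattice translation `fockTranslate v` (a BLOCH
  ground state), then it holds for every normalised sector ground state. Proof: the MAXIMUM of the
  Rayleigh quotient of the Hermitian, translation-invariant `A_w` over the unit sphere of the
  (translation-invariant) sector ground eigenspace is attained at a joint eigenvector of the two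
  unit translations (`exists_unit_common_eigenvector_isMinOn` of the sibling crux's Bloch file,
  applied to `-A_w`), hence of all translations.
* §3 `windowInfraredBound_iff_bloch` (and the `KacWindowPenalty` copy): **the crux is equivalent
  to its restriction to Bloch ground states**, with the SAME `(C, ε₀, L₀)`. So a proof may assume
  a crystal momentum for `ψ`, and a refutation must exhibit super-Goldstone window weight on a
  Bloch ground state; superpositions across momenta never matter. In a Bloch vector the pair
  structure factor is the Fourier transform of a genuine correlation FUNCTION
  (`pairStructureFactor_eq_sum_corr_of_bloch`: `S_ψ(m) = Re Σ_z conj χ_m(z) ⟨P_0 ψ, P_z ψ⟩`).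

H. Tasaki, *Physics and Mathematics of Quantum Many-Body Systems* (2020) §2.1 (variational
principle), §4.1 (translation invariance, momentum eigenstates); Kennedy–Lieb–Shastry,
PRL 61 (1988) 2582 (Fourier modes of the order field). No definition is introduced.
-/

noncomputable section

-- the summit namespace `Summit.HubbardSuperconductivity.HubbardSuperconductivity.…` repeats the problem name by design (D-0017)
set_option linter.dupNamespace false

namespace Summit.HubbardSuperconductivity.HubbardSuperconductivity.Theorems.WindowInfraredBound

open Matrix Finset
open Literature.Probability.LatticeModels Literature.MathematicalPhysics.QuantumLattice
open Summit.HubbardSuperconductivity.HubbardSuperconductivity.Theses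
open Summit.HubbardSuperconductivity.HubbardSuperconductivity.Theorems.FunctionFieldCertificate
  (exists_unit_common_eigenvector_isMinOn fockTranslate_add_val conjTranspose_fockTranslate_val
    fockTranslate_mulVec_mem_ground forall_fockTranslate_mulVec_eq_smul_of_generators
    corr_add_eq_of_bloch)
open scoped ComplexOrder ComplexConjugate

/-! ### §1 Translation covariance of the momentum-resolved pair field -/

section Covariance

variable {L : ℕ} [NeZero L] (g : Site 2 → ℝ)

/-- **`T_v Δ_g(m) T_v⁻¹ = χ_m(v) • Δ_g(m)`**: the momentum-resolved pair field
`Δ_g(m) = Σ_x conj χ_m(x) • P_x` is translation covariant with the Bloch phase `χ_m(v)`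
(`T_v P_x T_v⁻¹ = P_{x+v}` and `conj χ_m(x) = χ_m(v) conj χ_m(x + v)`).
Tasaki (2020) §4.1. [folklore] -/
theorem relabel_translate_pairFieldAt (v m : TorusSite 2 L) :
    relabel (Orb.translate v) (pairFieldAt g L m) = torusChar m v • pairFieldAt g L m := by
  rw [pairFieldAt_eq_sum_torusChar, relabel_sum, Finset.smul_sum]
  simp_rw [relabel_smul, relabel_translate_localPair, smul_smul]
  refine Fintype.sum_equiv (Equiv.addRight v) _ _ fun x => ?_
  simp only [Equiv.coe_addRight]
  rw [torusChar_add_right, map_mul, ← mul_assoc, mul_comm (torusChar m v) _, mul_assoc,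
    torusChar_mul_conj, mul_one]

/-- **`T_v (Δ_g(m)ᴴ Δ_g(m)) T_v⁻¹ = Δ_g(m)ᴴ Δ_g(m)`** (`|χ_m(v)| = 1`). [folklore] -/
theorem relabel_translate_pairFieldAt_conjTranspose_mul (v m : TorusSite 2 L) :
    relabel (Orb.translate v) ((pairFieldAt g L m)ᴴ * pairFieldAt g L m) =
      (pairFieldAt g L m)ᴴ * pairFieldAt g L m := by
  rw [relabel_mul, relabel_conjTranspose, relabel_translate_pairFieldAt, conjTranspose_smul,
    Matrix.smul_mul, Matrix.mul_smul, smul_smul, Complex.star_def, mul_comm, torusChar_mul_conj,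
    one_smul]

/-- `[T_v, Δ_g(m)ᴴ Δ_g(m)] = 0`. [folklore] -/
theorem fockTranslate_commute_pairFieldAt_conjTranspose_mul (v m : TorusSite 2 L) :
    Commute (fockTranslate v).val ((pairFieldAt g L m)ᴴ * pairFieldAt g L m) :=
  fockRelabel_commute_of_relabel_eq _ (relabel_translate_pairFieldAt_conjTranspose_mul g v m)

/-- **The pair structure factor is translation invariant**: `S_{T_v ψ}(m) = S_ψ(m)`. [folklore] -/
theorem pairStructureFactor_fockTranslate_mulVec (v m : TorusSite 2 L)
    (ψ : Fock (Orb (FermionTorus 2 L))) :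
    pairStructureFactor g L ((fockTranslate v).val *ᵥ ψ) m = pairStructureFactor g L ψ m := by
  rw [pairStructureFactor_eq_expect, pairStructureFactor_eq_expect]
  have h := expect_relabel_fockRelabel_mulVec (Orb.translate v)
    ((pairFieldAt g L m)ᴴ * pairFieldAt g L m) ψ
  rw [relabel_translate_pairFieldAt_conjTranspose_mul] at h
  change expect ((pairFieldAt g L m)ᴴ * pairFieldAt g L m) ((fockTranslate v).val *ᵥ ψ) =
    expect ((pairFieldAt g L m)ᴴ * pairFieldAt g L m) ψ at h
  rw [h]

/-- **A real-weighted mode sum `A_w = Σ_m w_m • Δ_g(m)ᴴ Δ_g(m)` is Hermitian.** [folklore] -/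
theorem isHermitian_modeSum (w : TorusSite 2 L → ℝ) :
    (∑ m : TorusSite 2 L, ((w m : ℝ) : ℂ) • ((pairFieldAt g L m)ᴴ * pairFieldAt g L m)).IsHermitian := by
  unfold Matrix.IsHermitian
  rw [conjTranspose_sum]
  refine Finset.sum_congr rfl fun m _ => ?_
  rw [conjTranspose_smul, conjTranspose_mul, conjTranspose_conjTranspose, Complex.star_def,
    Complex.conj_ofReal]

/-- **`A_w` is translation invariant**: `T_v A_w T_v⁻¹ = A_w`. [folklore] -/
theorem relabel_translate_modeSum (w : TorusSite 2 L → ℝ) (v : TorusSite 2 L) :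
    relabel (Orb.translate v)
        (∑ m : TorusSite 2 L, ((w m : ℝ) : ℂ) • ((pairFieldAt g L m)ᴴ * pairFieldAt g L m)) =
      ∑ m : TorusSite 2 L, ((w m : ℝ) : ℂ) • ((pairFieldAt g L m)ᴴ * pairFieldAt g L m) := by
  rw [relabel_sum]
  simp_rw [relabel_smul, relabel_translate_pairFieldAt_conjTranspose_mul]

/-- `[T_v, A_w] = 0`. [folklore] -/
theorem fockTranslate_commute_modeSum (w : TorusSite 2 L → ℝ) (v : TorusSite 2 L) :
    Commute (fockTranslate v).val
      (∑ m : TorusSite 2 L, ((w m : ℝ) : ℂ) • ((pairFieldAt g L m)ᴴ * pairFieldAt g L m)) :=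
  fockRelabel_commute_of_relabel_eq _ (relabel_translate_modeSum g w v)

/-- **The Rayleigh quotient of `A_w` is the weighted mode sum**:
`Re⟨ψ, A_w ψ⟩ = Σ_m w_m ‖Δ_g(m) ψ‖²`. [folklore] -/
theorem re_star_dotProduct_modeSum_mulVec (w : TorusSite 2 L → ℝ) (ψ : Fock (Orb (FermionTorus 2 L))) :
    (star ψ ⬝ᵥ
        ((∑ m : TorusSite 2 L, ((w m : ℝ) : ℂ) • ((pairFieldAt g L m)ᴴ * pairFieldAt g L m)) *ᵥ ψ)).re =
      ∑ m : TorusSite 2 L, w m * (star (pairFieldAt g L m *ᵥ ψ) ⬝ᵥ (pairFieldAt g L m *ᵥ ψ)).re := by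
  rw [sum_mulVec, dotProduct_sum, Complex.re_sum]
  refine Finset.sum_congr rfl fun m _ => ?_
  rw [smul_mulVec, dotProduct_smul, smul_eq_mul, Complex.re_ofReal_mul,
    star_mulVec_dotProduct_mulVec]

end Covariance

/-! ### §2 Weighted mode sums over the ground multiplet are maximised at Bloch ground states -/

section Bloch

variable {L : ℕ} [NeZero L]

/-- **Bloch reduction of an every-ground-state UPPER bound, at fixed data.** If on the torus of
side `L` every normalised `(N, S^z = M)`-sector ground state of `hubbardTorus 2 L t U` that is an
eigenvector of EVERY lattice translation `T_v` has `Σ_m w_m ‖Δ_g(m) ψ‖² ≤ b` (real weights `w`,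
any form factor `g`), then so does every normalised sector ground state. Proof: the sector ground
eigenspace `G` is invariant under the translations and their adjoints, `A_w` is Hermitian and
commutes with them, so by `exists_unit_common_eigenvector_isMinOn` applied to `-A_w` the MAXIMUM
of `Re⟨φ, A_w φ⟩ = Σ_m w_m ‖Δ_g(m) φ‖²` over the unit vectors of `G` is attained at a joint
eigenvector of `T_{e₁}, T_{e₂}`, hence of every `T_v`. Tasaki (2020) §2.1, §4.1. [folklore] -/
theorem forall_ground_modeSum_le_of_bloch (L : ℕ) [NeZero L] (g : Site 2 → ℝ) (t U : ℝ) (N : ℕ)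
    (M : ℝ) (w : TorusSite 2 L → ℝ) (b : ℝ)
    (h : ∀ ψ : Fock (Orb (FermionTorus 2 L)), star ψ ⬝ᵥ ψ = 1 →
      IsGroundStateInSector (hubbardTorus 2 L t U) N M ψ →
        (∀ v : TorusSite 2 L, ∃ c : ℂ, (fockTranslate v).val *ᵥ ψ = c • ψ) →
          ∑ m : TorusSite 2 L, w m * (star (pairFieldAt g L m *ᵥ ψ) ⬝ᵥ (pairFieldAt g L m *ᵥ ψ)).re ≤ b)
    (ψ : Fock (Orb (FermionTorus 2 L))) (hψ : star ψ ⬝ᵥ ψ = 1)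
    (hgs : IsGroundStateInSector (hubbardTorus 2 L t U) N M ψ) :
    ∑ m : TorusSite 2 L, w m * (star (pairFieldAt g L m *ᵥ ψ) ⬝ᵥ (pairFieldAt g L m *ᵥ ψ)).re ≤ b := by
  set H := hubbardTorus 2 L t U with hH
  set E : ℂ := ((H.minEnergyOn (szSector (Λ := FermionTorus 2 L) N M) : ℝ) : ℂ) with hEdef
  -- the sector ground eigenspace
  set G : Submodule ℂ (Fock (Orb (FermionTorus 2 L))) :=
    szSector (Λ := FermionTorus 2 L) N M ⊓ Module.End.eigenspace (Matrix.toLin' H) E with hG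
  have hmemG : ∀ φ : Fock (Orb (FermionTorus 2 L)),
      φ ∈ G ↔ φ ∈ szSector (Λ := FermionTorus 2 L) N M ∧ H *ᵥ φ = E • φ := fun φ => by
    rw [hG, Submodule.mem_inf, Module.End.mem_eigenspace_iff, Matrix.toLin'_apply]
  have hψG : ψ ∈ G := (hmemG ψ).2 ⟨hgs.1, hgs.2.2⟩
  -- the weighted mode sum and its negative
  set A : Matrix (Finset (Orb (FermionTorus 2 L))) (Finset (Orb (FermionTorus 2 L))) ℂ :=
    ∑ m : TorusSite 2 L, ((w m : ℝ) : ℂ) • ((pairFieldAt g L m)ᴴ * pairFieldAt g L m) with hA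
  have hAH : (-A).IsHermitian := (isHermitian_modeSum g w).neg
  set T₁ := (fockTranslate (Pi.single 0 1 : TorusSite 2 L)).val with hT₁
  set T₂ := (fockTranslate (Pi.single 1 1 : TorusSite 2 L)).val with hT₂
  have h12 : Commute T₁ T₂ := by
    change (fockTranslate (Pi.single 0 1 : TorusSite 2 L)).val *
        (fockTranslate (Pi.single 1 1 : TorusSite 2 L)).val =
      (fockTranslate (Pi.single 1 1 : TorusSite 2 L)).val *
        (fockTranslate (Pi.single 0 1 : TorusSite 2 L)).val
    rw [← fockTranslate_add_val, ← fockTranslate_add_val, add_comm]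
  have hGinv : ∀ v : TorusSite 2 L, ∀ φ ∈ G, (fockTranslate v).val *ᵥ φ ∈ G := by
    intro v φ hφ
    obtain ⟨hφS, hφE⟩ := (hmemG φ).1 hφ
    exact (hmemG _).2 (fockTranslate_mulVec_mem_ground t U N M E v hφS hφE)
  have hGinv' : ∀ v : TorusSite 2 L, ∀ φ ∈ G, ((fockTranslate v).val)ᴴ *ᵥ φ ∈ G := by
    intro v φ hφ
    rw [conjTranspose_fockTranslate_val]
    exact hGinv (-v) φ hφ
  obtain ⟨φ, hφG, hφ1, hc₁, hc₂, hmin⟩ := exists_unit_common_eigenvector_isMinOn hAH G ⟨ψ, hψG, hψ⟩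
    h12 (fockTranslate_commute_modeSum g w _).neg_right (fockTranslate_commute_modeSum g w _).neg_right
    (hGinv _) (hGinv' _) (hGinv _) (hGinv' _)
  -- `φ` is a Bloch ground state
  have hbloch := forall_fockTranslate_mulVec_eq_smul_of_generators hc₁ hc₂
  obtain ⟨hφS, hφE⟩ := (hmemG φ).1 hφG
  have hφ0 : φ ≠ 0 := by
    intro h0
    rw [h0, star_zero, zero_dotProduct] at hφ1
    exact zero_ne_one hφ1
  have hφgs : IsGroundStateInSector H N M φ := ⟨hφS, hφ0, hφE⟩
  have hbφ := h φ hφ1 hφgs hbloch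
  -- `Re⟨ψ, A ψ⟩ ≤ Re⟨φ, A φ⟩ ≤ b`
  have hle := hmin ψ hψG hψ
  rw [neg_mulVec, neg_mulVec, dotProduct_neg, dotProduct_neg, Complex.neg_re, Complex.neg_re,
    neg_le_neg_iff, re_star_dotProduct_modeSum_mulVec, re_star_dotProduct_modeSum_mulVec] at hle
  exact hle.trans hbφ

/-- **Window form.** The same reduction for the crux's window functional
`Σ_{m ≠ 0, |q_m| ≤ ε} S_ψ(m)` (`S_ψ = pairStructureFactor g L ψ`): an upper bound valid on every
Bloch sector ground state is valid on every sector ground state. [folklore] -/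
theorem forall_ground_windowSum_le_of_bloch (L : ℕ) [NeZero L] (g : Site 2 → ℝ) (t U : ℝ) (N : ℕ)
    (M : ℝ) (ε b : ℝ)
    (h : ∀ ψ : Fock (Orb (FermionTorus 2 L)), star ψ ⬝ᵥ ψ = 1 →
      IsGroundStateInSector (hubbardTorus 2 L t U) N M ψ →
        (∀ v : TorusSite 2 L, ∃ c : ℂ, (fockTranslate v).val *ᵥ ψ = c • ψ) →
          (∑ m : TorusSite 2 L, if m ≠ 0 ∧ momentumNormSq L m ≤ ε ^ 2 then
              pairStructureFactor g L ψ m else 0) ≤ b)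
    (ψ : Fock (Orb (FermionTorus 2 L))) (hψ : star ψ ⬝ᵥ ψ = 1)
    (hgs : IsGroundStateInSector (hubbardTorus 2 L t U) N M ψ) :
    (∑ m : TorusSite 2 L, if m ≠ 0 ∧ momentumNormSq L m ≤ ε ^ 2 then
        pairStructureFactor g L ψ m else 0) ≤ b := by
  classical
  -- window weights `w_m = 1_{window}(m) / L²`
  set w : TorusSite 2 L → ℝ := fun m =>
    if m ≠ 0 ∧ momentumNormSq L m ≤ ε ^ 2 then ((L : ℝ) ^ 2)⁻¹ else 0 with hw
  have hsum : ∀ φ : Fock (Orb (FermionTorus 2 L)),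
      (∑ m : TorusSite 2 L, if m ≠ 0 ∧ momentumNormSq L m ≤ ε ^ 2 then
          pairStructureFactor g L φ m else 0) =
        ∑ m : TorusSite 2 L, w m * (star (pairFieldAt g L m *ᵥ φ) ⬝ᵥ (pairFieldAt g L m *ᵥ φ)).re := by
    intro φ
    refine Finset.sum_congr rfl fun m _ => ?_
    simp only [hw, pairStructureFactor_apply]
    split_ifs
    · rw [div_eq_inv_mul]
    · rw [zero_mul]
  rw [hsum]
  exact forall_ground_modeSum_le_of_bloch L g t U N M w b
    (fun φ hφ hφgs hbl => (hsum φ) ▸ h φ hφ hφgs hbl) ψ hψ hgs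

/-- **In a Bloch vector the pair structure factor is the Fourier transform of the pair correlation
FUNCTION**: `S_ψ(m) = Re Σ_z conj χ_m(z) ⟨P_0 ψ, P_z ψ⟩` whenever `T_v ψ = c_v ψ` for all `v`
(`‖Δ_g(m)ψ‖² = Σ_{x,y} χ_m(x) conj χ_m(y) ⟨P_x ψ, P_y ψ⟩` and `⟨P_x ψ, P_y ψ⟩ = ⟨P_0 ψ, P_{y-x} ψ⟩`).
Kennedy–Lieb–Shastry, PRL 61 (1988) 2582 (`g_p` of a translation-invariant state). [folklore] -/
theorem pairStructureFactor_eq_sum_corr_of_bloch (g : Site 2 → ℝ) {ψ : Fock (Orb (FermionTorus 2 L))}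
    (hψ : ∀ v : TorusSite 2 L, ∃ c : ℂ, (fockTranslate v).val *ᵥ ψ = c • ψ) (m : TorusSite 2 L) :
    pairStructureFactor g L ψ m =
      (∑ z : TorusSite 2 L, conj (torusChar m z) *
        (star (localPair g L 0 *ᵥ ψ) ⬝ᵥ (localPair g L z *ᵥ ψ))).re := by
  have hL : ((L : ℝ) ^ 2) ≠ 0 := pow_ne_zero _ (Nat.cast_ne_zero.2 (NeZero.ne L))
  rw [pairStructureFactor_apply, div_eq_iff hL]
  -- expand `‖Δ_g(m)ψ‖²` as a double sum
  have hexp : star (pairFieldAt g L m *ᵥ ψ) ⬝ᵥ (pairFieldAt g L m *ᵥ ψ) =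
      ∑ x : TorusSite 2 L, ∑ y : TorusSite 2 L, torusChar m x * conj (torusChar m y) *
        (star (localPair g L x *ᵥ ψ) ⬝ᵥ (localPair g L y *ᵥ ψ)) := by
    rw [pairFieldAt_eq_sum_torusChar, sum_mulVec, star_sum, sum_dotProduct]
    refine Finset.sum_congr rfl fun x _ => ?_
    rw [dotProduct_sum]
    refine Finset.sum_congr rfl fun y _ => ?_
    rw [smul_mulVec, smul_mulVec, star_smul, smul_dotProduct, dotProduct_smul, smul_smul,
      smul_eq_mul, Complex.star_def, starRingEnd_self_apply]
  -- in a Bloch vector the inner sum does not depend on `x`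
  have hinner : ∀ x : TorusSite 2 L,
      ∑ y : TorusSite 2 L, torusChar m x * conj (torusChar m y) *
          (star (localPair g L x *ᵥ ψ) ⬝ᵥ (localPair g L y *ᵥ ψ)) =
        ∑ z : TorusSite 2 L, conj (torusChar m z) *
          (star (localPair g L 0 *ᵥ ψ) ⬝ᵥ (localPair g L z *ᵥ ψ)) := by
    intro x
    symm
    refine Fintype.sum_equiv (Equiv.addRight x) _ _ fun z => ?_
    simp only [Equiv.coe_addRight]
    rw [← corr_add_eq_of_bloch g x 0 z (hψ x), zero_add, torusChar_add_right, map_mul, ← mul_assoc,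
      mul_comm (torusChar m x), mul_assoc (conj (torusChar m z)), torusChar_mul_conj, mul_one]
  rw [hexp]
  simp_rw [hinner]
  rw [Finset.sum_const, Finset.card_univ, Fintype.card_fun, ZMod.card, Fintype.card_fin,
    nsmul_eq_mul, ← Complex.ofReal_natCast, Complex.re_ofReal_mul, Nat.cast_pow, mul_comm]

end Bloch

/-! ### §3 The crux needs Bloch ground states only -/

/-- **Bloch reduction of the crux.** `WindowInfraredBound` is equivalent to the same statement with
the ground states restricted to BLOCH ground states — normalised `(N_L, S^z = 0)`-sector ground
states of `hubbardTorus 2 L 1 U` that are eigenvectors of every lattice translation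
`fockTranslate v` — with the same `(C, ε₀, L₀)` (`→`: drop the hypothesis; `←`:
`forall_ground_windowSum_le_of_bloch` at `b = C ε L²`; the crux is its `pairStructureFactor` form
by `wib_iff_pairStructureFactor`, `Iff.rfl`). Tasaki (2020) §2.1, §4.1. [folklore] -/
theorem windowInfraredBound_iff_bloch : FunctionFieldCertificate.WindowInfraredBound ↔
    ∀ U : ℝ, 0 < U → ∀ δ ∈ Set.Ioo (0:ℝ) (1 / 2), ∃ C ε₀ : ℝ, 0 ≤ C ∧ 0 < ε₀ ∧ ∃ L₀ : ℕ,
      ∀ ε ∈ Set.Ioc (0:ℝ) ε₀, ∀ (L : ℕ) [NeZero L], L₀ ≤ L → Even L →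
        ∀ ψ : Fock (Orb (FermionTorus 2 L)), star ψ ⬝ᵥ ψ = 1 →
          IsGroundStateInSector (hubbardTorus 2 L 1 U) (2 * ⌊(1 - δ) * (L : ℝ) ^ 2 / 2⌋₊) 0 ψ →
            (∀ v : TorusSite 2 L, ∃ c : ℂ, (fockTranslate v).val *ᵥ ψ = c • ψ) →
              (∑ m : TorusSite 2 L, if m ≠ 0 ∧ momentumNormSq L m ≤ ε ^ 2 then
                  pairStructureFactor dWaveFormFactor L ψ m else 0) ≤ C * ε * (L : ℝ) ^ 2 := by
  rw [wib_iff_pairStructureFactor]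
  constructor
  · intro hW U hU δ hδ
    obtain ⟨C, ε₀, hC, hε₀, L₀, hall⟩ := hW U hU δ hδ
    exact ⟨C, ε₀, hC, hε₀, L₀, fun ε hε L _ hL₀ hE ψ hψ hgs _ => hall ε hε L hL₀ hE ψ hψ hgs⟩
  · intro hB U hU δ hδ
    obtain ⟨C, ε₀, hC, hε₀, L₀, hall⟩ := hB U hU δ hδ
    refine ⟨C, ε₀, hC, hε₀, L₀, fun ε hε L _ hL₀ hE ψ hψ hgs => ?_⟩
    exact forall_ground_windowSum_le_of_bloch L dWaveFormFactor 1 U _ 0 ε (C * ε * (L : ℝ) ^ 2)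
      (fun φ hφ hφgs hbl => hall ε hε L hL₀ hE φ hφ hφgs hbl) ψ hψ hgs

/-- **Bloch reduction of the `KacWindowPenalty` copy of the crux** (the two route decls are the same
proposition, `wib_functionField_iff_kac`). [folklore] -/
theorem kacWindowInfraredBound_iff_bloch : KacWindowPenalty.WindowInfraredBound ↔
    ∀ U : ℝ, 0 < U → ∀ δ ∈ Set.Ioo (0:ℝ) (1 / 2), ∃ C ε₀ : ℝ, 0 ≤ C ∧ 0 < ε₀ ∧ ∃ L₀ : ℕ,
      ∀ ε ∈ Set.Ioc (0:ℝ) ε₀, ∀ (L : ℕ) [NeZero L], L₀ ≤ L → Even L →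
        ∀ ψ : Fock (Orb (FermionTorus 2 L)), star ψ ⬝ᵥ ψ = 1 →
          IsGroundStateInSector (hubbardTorus 2 L 1 U) (2 * ⌊(1 - δ) * (L : ℝ) ^ 2 / 2⌋₊) 0 ψ →
            (∀ v : TorusSite 2 L, ∃ c : ℂ, (fockTranslate v).val *ᵥ ψ = c • ψ) →
              (∑ m : TorusSite 2 L, if m ≠ 0 ∧ momentumNormSq L m ≤ ε ^ 2 then
                  pairStructureFactor dWaveFormFactor L ψ m else 0) ≤ C * ε * (L : ℝ) ^ 2 :=
  wib_functionField_iff_kac.symm.trans windowInfraredBound_iff_bloch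

/-- **Sufficiency form for provers**: a window bound proved on Bloch sector ground states only
closes the crux. [folklore] -/
theorem windowInfraredBound_of_bloch
    (h : ∀ U : ℝ, 0 < U → ∀ δ ∈ Set.Ioo (0:ℝ) (1 / 2), ∃ C ε₀ : ℝ, 0 ≤ C ∧ 0 < ε₀ ∧ ∃ L₀ : ℕ,
      ∀ ε ∈ Set.Ioc (0:ℝ) ε₀, ∀ (L : ℕ) [NeZero L], L₀ ≤ L → Even L →
        ∀ ψ : Fock (Orb (FermionTorus 2 L)), star ψ ⬝ᵥ ψ = 1 →
          IsGroundStateInSector (hubbardTorus 2 L 1 U) (2 * ⌊(1 - δ) * (L : ℝ) ^ 2 / 2⌋₊) 0 ψ →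
            (∀ v : TorusSite 2 L, ∃ c : ℂ, (fockTranslate v).val *ᵥ ψ = c • ψ) →
              (∑ m : TorusSite 2 L, if m ≠ 0 ∧ momentumNormSq L m ≤ ε ^ 2 then
                  pairStructureFactor dWaveFormFactor L ψ m else 0) ≤ C * ε * (L : ℝ) ^ 2) :
    FunctionFieldCertificate.WindowInfraredBound :=
  windowInfraredBound_iff_bloch.2 h

end Summit.HubbardSuperconductivity.HubbardSuperconductivity.Theorems.WindowInfraredBound
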